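/-
Copyright (c) 2026 the pub-hodgecm-mathlib formalisation cell (harness21).  Prover seat hodgecm-mathlib-K2Liu-p03 (g6∕g7): Track B «K2-LIT»,
#184♮ = hLiu418 = stmt-HodgeConjecture-24832, road `K2_Liu`, Road I organ (A-int)-fin, A7-reg (GK COCYCLE road), file B8
(RULINGS M-156m′ (B8 = K2Liu-p03) ∕ M-157a (4) ∕ M-157c (2): the good-place bridge (A4′-R) → (A4′); §1–§3 B7-independent (g6), §4 = B7 ★ p859512 applied (g7)).
-/
import Summits.HodgeConjecture.HodgeConjecture.Theorems.K2LiuLocalSiegelIwasawa       -- ★ `exists_isSiegelDelta_mul_mem_localInt` (local Iwasawa at good places)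
import Summits.HodgeConjecture.HodgeConjecture.Theorems.K2LiuA7NormalisedRegularity  -- ★ B7 (K2Liu-p09, p859512): `normalisedRegularity` — (A4′-R) at every finite place, rank 2
import HarnessLib

/-!
# Crux `HLiu418`, road `K2_Liu`, organ (A-int)-fin, A7-reg file B8 (B7-independent §§): AT A GOOD PLACE THE IWASAWA BINDERS ⟦R-Iw⟧ OF THE (A4′-R) FACE
# ARE DISCHARGED BY `K₀ := H(𝒪_v) = UnitaryGroup.localInt`

Cell `hodgecm-mathlib`, crux item hLiu418 = `stmt-HodgeConjecture-24832`; squad K2 ∕ K2Liu; prover K2Liu-p03 (g6).  THEOREMS ONLY (no `def`, no instance,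
no notation, no named-fact hypothesis, no `sorry`); lane `--supports stmt-HodgeConjecture-24832 --as helper`.

The faces of record (A4′-R) ∕ (A4″-KR) of the A7-reg organ (RULING M-156m; twin `K2/K2Liu-p03/g6/FaceA4R.K2Liu-p03-g6.lean` e56f811bc64cfc2c, typed as B7
`K2LiuA7NormalisedRegularity` by K2Liu-p09) quantify over an IWASAWA COMPACT `K₀ ≤ H_v = U(T₀ ⊕ −T₀)(F_v)` given as DATA with two hypotheses:
⟦R-Iw⟧ `IsCompact K₀ ∧ IsOpen K₀` and `∀ g, ∃ p ∈ P_Δ(F_v), ∃ k ∈ K₀, g = p k`.  At a GOOD place (`v ∤ 2`, `T₀` and `T₀⁻¹` integral at every `w ∣ v`,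
`det T₀ ≠ 0`) the hyperspecial compact `K₀ := H(𝒪_v)` satisfies both (★ `isCompact_localInt`, ★ `isOpen_localInt`, ★ `exists_isSiegelDelta_mul_mem_localInt`),
so any statement proved for all Iwasawa compacts holds for `H(𝒪_v)` — the v3.15 `localInt`-flat (A4′) face follows from (A4′-R) by instantiation (§3).
At a BAD place there is no such bridge (a `localInt`-flat family need not be `K₀`-flat for an Iwasawa compact `K₀`; K2Liu-p01 (W3)∕(F-Iw)), which is why the
faces of record carry `K₀` as data.  Generic D10 datum `(F, E, c, δ, d, v, n, T₀, JD)`; no reference to B7's statement (B7-independent).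
* §1 `isCompact_and_isOpen_localInt` — ⟦R-Iw⟧(a) for `K₀ := localInt`.
* §2 `exists_isSiegelDelta_and_mem_localInt` — ⟦R-Iw⟧(b) for `K₀ := localInt` at a good place, in the face's binder shape `∃ p, IsSiegelDelta p ∧ ∃ k ∈ K₀, g = p * k`.
* §3 `of_forall_iwasawaCompact` — THE BRIDGE: `(∀ K₀, ⟦R-Iw⟧(a) → ⟦R-Iw⟧(b) → P K₀) → P (localInt)` at a good place, for every `P : Subgroup H_v → Prop`.
* §4 **`normalisedRegularity_localInt`** — B7 ★ `K2LiuA7NormalisedRegularity.normalisedRegularity` (rank 2, every finite place, Iwasawa compact `K₀` as data) AT A GOOD PLACE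
  with `K₀ := H(𝒪_v)`: the v3.15 `localInt`-flat (A4′) face — for `χ_v` unitary and a family `f` of smooth Siegel sections of `I_v(s, χ_v)` flat on `H(𝒪_v)`,
  `M_v(s)(f s) h = aNorm 2 χ_v (νN(N_Δ ∩ H(𝒪_v))) s · Fn s h` on `1 < re s` with `Fn(· , h)` `q_v^{-s}`-rational and regular at `½`.
HONEST LABEL.  Count-neutral helper: `HC_CM` is proved only modulo the 7 printed citations (2 remaining named inputs: hLiu418 = `stmt-HodgeConjecture-24832`,
h413 = `stmt-HodgeConjecture-24833`) until rung 0 closes.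

## References
* [BruhatTits1972] F. Bruhat, J. Tits, Publ. IHÉS 41 (1972): Prop. (4.4.3) (Iwasawa decomposition `G = PK` for a hyperspecial `K`).
* [Casselman1980] W. Casselman, Compositio Math. 40 (1980): §3 (spherical vectors via `G = PK`; good places).
* [PlatonovRapinchuk1994] V. Platonov, A. Rapinchuk, *Algebraic Groups and Number Theory* (1994): §5.1 (`G(𝒪_v)` compact open).
* [HarrisKudlaSweet1996] M. Harris, S. Kudla, W. J. Sweet, J. AMS 9 (1996): §1 (1.11), §6 (6.14)–(6.16).
* [KudlaSweet1997] S. Kudla, W. J. Sweet, *Degenerate principal series representations for U(n,n)*, Israel J. Math. 98 (1997): §1.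
-/

set_option autoImplicit false
set_option linter.dupNamespace false -- the mandated namespace repeats `HodgeConjecture.HodgeConjecture`

noncomputable section

open NumberField IsDedekindDomain Matrix Topology
open Literature.NumberTheory.Automorphic Literature.NumberTheory.Automorphic.UnitaryGroup
open Literature.NumberTheory.GelbartRogawski1991.UnitaryDualPair.LocalSplitting
open Summit.HodgeConjecture.HodgeConjecture.Cruxes.HLiu418.K2LiuLocalSiegelIwasawa
open Literature.NumberTheory.GaloisRepresentations.IsNonarchimedeanLocalField
open Literature.NumberTheory.K2Lit.LocalSiegelDoubled
open Summit.HodgeConjecture.HodgeConjecture.Cruxes.HLiu418.K2LiuQRationalDefs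
open Summit.HodgeConjecture.HodgeConjecture.Cruxes.HLiu418.K2LiuLocalLFactorDefs

namespace Summit.HodgeConjecture.HodgeConjecture.Cruxes.HLiu418.K2LiuA7GoodPlaceBridge

variable (F : Type) [Field F] [NumberField F] (E : Type) [Field E] [NumberField E] [Algebra F E]
  [Algebra.IsQuadraticExtension F E] (c : E ≃ₐ[F] E)
  {δ : E} (hcδ : c δ = -δ) (hδ : δ ≠ 0) {d : F} (hd : δ * δ = algebraMap F E d)
  (v : HeightOneSpectrum (𝓞 F)) (n : ℕ) {T₀ : Matrix (Fin n) (Fin n) F} (hT₀ : T₀.IsSymm)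
  {JD : Matrix (Fin (n + n)) (Fin (n + n)) E} (hJD : JD = (gramD F n T₀).map (algebraMap F E))

/-! ## §1 ⟦R-Iw⟧(a): `H(𝒪_v)` is a compact open subgroup -/

omit [Algebra.IsQuadraticExtension F E] in
/-- **`H(𝒪_v) = UnitaryGroup.localInt` is compact and open in `H_v`** — binder `_hK₀` of the (A4′-R)∕(A4″-KR) faces for `K₀ := localInt`.
[cite: PlatonovRapinchuk1994, §5.1] -/
theorem isCompact_and_isOpen_localInt :
    IsCompact (UnitaryGroup.localInt E c (n + n) JD v : Set (UnitaryGroup.localPi E c (n + n) JD v)) ∧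
      IsOpen (UnitaryGroup.localInt E c (n + n) JD v : Set (UnitaryGroup.localPi E c (n + n) JD v)) :=
  ⟨UnitaryGroup.isCompact_localInt E c (n + n) JD v, UnitaryGroup.isOpen_localInt E c (n + n) JD v⟩

/-! ## §2 ⟦R-Iw⟧(b): `H_v = P_Δ(F_v) · H(𝒪_v)` at a good place, in the face's binder shape -/

include hcδ hδ hd hT₀ hJD in
/-- **`∀ g ∈ H_v, ∃ p ∈ P_Δ(F_v), ∃ k ∈ H(𝒪_v), g = p k` at a GOOD place** (`|2|_w = 1`, `T₀`, `T₀⁻¹` integral at every `w ∣ v`, `det T₀` a unit) — binder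
`_hIw` of the (A4′-R)∕(A4″-KR) faces for `K₀ := localInt` (★ `exists_isSiegelDelta_mul_mem_localInt`, reshaped). [cite: BruhatTits1972, (4.4.3)] [cite: Casselman1980, §3] -/
theorem exists_isSiegelDelta_and_mem_localInt (hT₀d : IsUnit T₀.det)
    (h2 : ∀ w : PlacesOver E v, ValuativeRel.valuation (w.1.adicCompletion E) (2 : w.1.adicCompletion E) = 1)
    (hT : ∀ (w : PlacesOver E v) (i j : Fin n),
      ValuativeRel.valuation (w.1.adicCompletion E) (algebraMap E (w.1.adicCompletion E) (algebraMap F E (T₀ i j))) ≤ 1)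
    (hTinv : ∀ (w : PlacesOver E v) (i j : Fin n),
      ValuativeRel.valuation (w.1.adicCompletion E) (algebraMap E (w.1.adicCompletion E) (algebraMap F E (T₀⁻¹ i j))) ≤ 1)
    (g : UnitaryGroup.localPi E c (n + n) JD v) :
    ∃ p : UnitaryGroup.localPi E c (n + n) JD v,
      IsSiegelDelta F E c hcδ hδ hd v n hT₀ hJD p ∧ ∃ k ∈ UnitaryGroup.localInt E c (n + n) JD v, g = p * k := by
  obtain ⟨p, k, hp, hk, hg⟩ := exists_isSiegelDelta_mul_mem_localInt F E c hcδ hδ hd v n hT₀ hJD hT₀d h2 hT hTinv g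
  exact ⟨p, hp, k, hk, hg⟩

/-! ## §3 The bridge: statements over all Iwasawa compacts specialise to `H(𝒪_v)` at a good place -/

include hcδ hδ hd hT₀ hJD in
/-- **THE GOOD-PLACE BRIDGE (A4′-R) → (A4′)**: if a property `P K₀` holds for every compact open `K₀ ≤ H_v` with `H_v = P_Δ(F_v)·K₀` (the shape of the
faces of record, B7), then at a good place it holds for `K₀ := H(𝒪_v)` (the shape of the v3.15 `localInt`-flat face).
[cite: Casselman1980, §3] [cite: HarrisKudlaSweet1996, §6 (6.14)–(6.16)] -/
theorem of_forall_iwasawaCompact {P : Subgroup (UnitaryGroup.localPi E c (n + n) JD v) → Prop}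
    (hP : ∀ K₀ : Subgroup (UnitaryGroup.localPi E c (n + n) JD v),
      IsCompact (K₀ : Set (UnitaryGroup.localPi E c (n + n) JD v)) ∧ IsOpen (K₀ : Set (UnitaryGroup.localPi E c (n + n) JD v)) →
      (∀ g : UnitaryGroup.localPi E c (n + n) JD v, ∃ p, IsSiegelDelta F E c hcδ hδ hd v n hT₀ hJD p ∧ ∃ k ∈ K₀, g = p * k) → P K₀)
    (hT₀d : IsUnit T₀.det)
    (h2 : ∀ w : PlacesOver E v, ValuativeRel.valuation (w.1.adicCompletion E) (2 : w.1.adicCompletion E) = 1)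
    (hT : ∀ (w : PlacesOver E v) (i j : Fin n),
      ValuativeRel.valuation (w.1.adicCompletion E) (algebraMap E (w.1.adicCompletion E) (algebraMap F E (T₀ i j))) ≤ 1)
    (hTinv : ∀ (w : PlacesOver E v) (i j : Fin n),
      ValuativeRel.valuation (w.1.adicCompletion E) (algebraMap E (w.1.adicCompletion E) (algebraMap F E (T₀⁻¹ i j))) ≤ 1) :
    P (UnitaryGroup.localInt E c (n + n) JD v) :=
  hP _ (isCompact_and_isOpen_localInt F E c v n) (exists_isSiegelDelta_and_mem_localInt F E c hcδ hδ hd v n hT₀ hJD hT₀d h2 hT hTinv)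

/-! ## §4 B7 applied: the `localInt`-flat (A4′) face at a good place (rank 2) -/

section RankTwo

include hcδ hδ hd in
/-- **B8 — (A4′) AT A GOOD PLACE: REGULARITY OF THE NORMALISED SIEGEL INTERTWINING OPERATOR AT `½` FOR `H(𝒪_v)`-FLAT FAMILIES.**  At a place `v ∤ 2` where `T₂`, `T₂⁻¹` are
integral and `det T₂` is a unit, for `χ_v` unitary and a family `f` of smooth Siegel sections of `I_v(s, χ_v)` whose restriction to `H(𝒪_v)` does not depend on `s`, there is
`Fn : ℂ → H_v → ℂ`, every `s ↦ Fn s h` rational in `q_v^{-s}` and regular at `½`, with `M_v(s)(f s) h = aNorm 2 χ_v (νN(N_Δ ∩ H(𝒪_v))) s · Fn s h` for `1 < re s` — ★ B7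
`normalisedRegularity` (Iwasawa compact `K₀` as data, adapted frame `(D, Dinv, Q)`) at `K₀ := H(𝒪_v)` through §1–§2.
[cite: KudlaSweet1997, §1] [cite: HarrisKudlaSweet1996, §6 (6.14)–(6.16)] [cite: Casselman1980, §3 Thm. 3.1] [cite: BruhatTits1972, (4.4.3)] -/
theorem normalisedRegularity_localInt {T₂ : Matrix (Fin 2) (Fin 2) F} (hT₂ : T₂.IsSymm) {J₂D : Matrix (Fin (2 + 2)) (Fin (2 + 2)) E}
    (hJ₂D : J₂D = (gramD F 2 T₂).map (algebraMap F E))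
    (D Dinv : Matrix (Fin 2) (Fin 2) F) (hDD : D * Dinv = 1) (hDD' : Dinv * D = 1) (Q : GL (Fin (2 + 2)) F)
    (hQm : (Q : Matrix (Fin (2 + 2)) (Fin (2 + 2)) F) = Matrix.reindex (e₂ 2) (e₂ 2) (Matrix.fromBlocks 1 D 1 (-D)))
    (hQ : (Q : Matrix (Fin (2 + 2)) (Fin (2 + 2)) F)ᵀ * gramD F 2 T₂ * (Q : Matrix (Fin (2 + 2)) (Fin (2 + 2)) F) = (StdForm.antidiagonal (2 + 2)).over F)
    [MeasurableSpace (unipDeltaLocal F E c v 2 (JD := J₂D))] [BorelSpace (unipDeltaLocal F E c v 2 (JD := J₂D))]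
    (νN : MeasureTheory.Measure (unipDeltaLocal F E c v 2 (JD := J₂D))) [νN.IsHaarMeasure]
    (χv : ∀ w : PlacesOver E v, (w.1.adicCompletion E)ˣ →* ℂˣ) (hχ : ∀ (w' : PlacesOver E v) (x : (w'.1.adicCompletion E)ˣ), ‖((χv w' x : ℂˣ) : ℂ)‖ = 1)
    (hT₀d : IsUnit T₂.det)
    (h2 : ∀ w : PlacesOver E v, ValuativeRel.valuation (w.1.adicCompletion E) (2 : w.1.adicCompletion E) = 1)
    (hT : ∀ (w : PlacesOver E v) (i j : Fin 2),
      ValuativeRel.valuation (w.1.adicCompletion E) (algebraMap E (w.1.adicCompletion E) (algebraMap F E (T₂ i j))) ≤ 1)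
    (hTinv : ∀ (w : PlacesOver E v) (i j : Fin 2),
      ValuativeRel.valuation (w.1.adicCompletion E) (algebraMap E (w.1.adicCompletion E) (algebraMap F E (T₂⁻¹ i j))) ≤ 1)
    (f : ℂ → UnitaryGroup.localPi E c (2 + 2) J₂D v → ℂ) (hSieg : ∀ s, IsLocalSiegelSection F E c hcδ hδ hd v 2 hT₂ hJ₂D χv s (f s))
    (hsm : ∀ s, IsSmooth F E c v 2 (f s))
    (hflat : ∀ s s' : ℂ, ∀ k ∈ UnitaryGroup.localInt E c (2 + 2) J₂D v, f s k = f s' k) :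
    ∃ Fn : ℂ → UnitaryGroup.localPi E c (2 + 2) J₂D v → ℂ,
      (∀ h, IsQRationalRegularAt (residueFieldCard (v.adicCompletion F)) (1 / 2) (fun s => Fn s h)) ∧
      ∀ s : ℂ, 1 < s.re → ∀ h : UnitaryGroup.localPi E c (2 + 2) J₂D v,
        localIntertwining F E c v 2 hJ₂D νN (f s) h =
          aNorm F E c v 2 χv (νN.real {u | (u : UnitaryGroup.localPi E c (2 + 2) J₂D v) ∈ UnitaryGroup.localInt E c (2 + 2) J₂D v}) s * Fn s h :=
  K2LiuA7NormalisedRegularity.normalisedRegularity F E c hcδ hδ hd v hT₂ hJ₂D D Dinv hDD hDD' Q hQm hQ νN χv hχ _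
    (isCompact_and_isOpen_localInt F E c v 2) (exists_isSiegelDelta_and_mem_localInt F E c hcδ hδ hd v 2 hT₂ hJ₂D hT₀d h2 hT hTinv) f hSieg hsm hflat

end RankTwo

end Summit.HodgeConjecture.HodgeConjecture.Cruxes.HLiu418.K2LiuA7GoodPlaceBridge

end
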